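import Mathlib
import Summits.NavierStokesRegularity.NavierStokesRegularity.Theorems.ThreadingFluxHorizonTowerDefs
import Summits.NavierStokesRegularity.NavierStokesRegularity.Theorems.ThreadingFluxHorizonTowerMixedDegreeRigidity
import Summits.NavierStokesRegularity.NavierStokesRegularity.Theorems.ThreadingFluxHorizonTowerZonalBridge
import Summits.NavierStokesRegularity.NavierStokesRegularity.Theorems.ThreadingFluxHorizonTowerZonalForm
import HarnessLib

/-!
# Crux `PoloidalLiouville` (stmt-NavierStokesRegularity-1222), crux idea «horizon-threading-tower» (ns-idea-15):
# `HorizonTower.TwoShellBracketZonality` BY NAME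

Support file (`--supports stmt-NavierStokesRegularity-1222`, helper; cell `ns-wall-extremal`, width hand ns-wall-eng-3 g3; 0 kit).
The typed statement `TwoShellBracketZonality` (Defs twin `ThreadingFluxHorizonTowerDefs.lean`, appended at the critic's price MX-1)
is closed by name from the polynomial theorem `Zonal.mixedDegreeBracketRigidity` (`…MixedDegreeRigidity.lean`): a smooth
`l`-homogeneous function is a homogeneous polynomial (`Zonal.exists_mvPolynomial_of_homogeneous`, ns-wall-eng-5 g4), the
polynomial theorem gives one common rotation axis `a`, and infinitesimal rotation invariance gives the zonal functional form
(`exists_zonalForm_of_inner_cross_gradient_eq_zero`, ns-wall-eng-5).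

HONEST LABEL: finite-dimensional algebra toward one crux idea's typed conjecture (`HorizonTowerZonality`, general towers, OPEN);
`PoloidalLiouville` (1222) OPEN; NS regularity NOT proved.
-/

-- the summit and its single sub-problem share the name (CONVENTIONS §1)
set_option linter.dupNamespace false

noncomputable section

namespace Summit.NavierStokesRegularity.NavierStokesRegularity.Theorems.PoloidalLiouville.HorizonTower

open scoped RealInnerProductSpace
open Literature.Analysis.FluidPDE (cross)
open MvPolynomial

/-- ★ `TwoShellBracketZonality` BY NAME: two nonzero solid harmonics of different degrees `l ≠ m` (`l, m ≥ 1`) with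
`⟪x, ∇A × ∇B⟫ ≡ 0` are zonal about one common axis. -/
theorem twoShellBracketZonality : TwoShellBracketZonality := by
  intro l m A B hl hm hlm hA hhomA hharmA hB hhomB hharmB hA0 hB0 hbr
  classical
  obtain ⟨p, hp, hAp⟩ := Zonal.exists_mvPolynomial_of_homogeneous hA hhomA
  obtain ⟨q, hq, hBq⟩ := Zonal.exists_mvPolynomial_of_homogeneous hB hhomB
  have hAfun : A = fun y : E3 => MvPolynomial.eval (fun i => y i) p := funext hAp
  have hBfun : B = fun y : E3 => MvPolynomial.eval (fun i => y i) q := funext hBq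
  have hp0 : p ≠ 0 := by
    rintro rfl
    obtain ⟨y, hy⟩ := hA0
    exact hy (by rw [hAp]; simp [Zonal.evalE])
  have hq0 : q ≠ 0 := by
    rintro rfl
    obtain ⟨y, hy⟩ := hB0
    exact hy (by rw [hBq]; simp [Zonal.evalE])
  have hpl : ∀ y : E3, Laplacian.laplacian (fun y : E3 => MvPolynomial.eval (fun i => y i) p) y = 0 := by
    intro y; rw [← hAfun]; exact hharmA y
  have hql : ∀ y : E3, Laplacian.laplacian (fun y : E3 => MvPolynomial.eval (fun i => y i) q) y = 0 := by
    intro y; rw [← hBfun]; exact hharmB y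
  have hbr' : ∀ y : E3, inner ℝ y (cross (gradient (fun y : E3 => MvPolynomial.eval (fun i => y i) p) y)
      (gradient (fun y : E3 => MvPolynomial.eval (fun i => y i) q) y)) = 0 := by
    intro y; rw [← hAfun, ← hBfun]; exact hbr y
  obtain ⟨n, hn, hnA, hnB⟩ := Zonal.mixedDegreeBracketRigidity l m p q hl hm hlm ⟨hp, hpl⟩ ⟨hq, hql⟩ hp0 hq0 hbr'
  rw [← hAfun] at hnA
  rw [← hBfun] at hnB
  have hdA : Differentiable ℝ A := hA.differentiable (by simp)
  have hdB : Differentiable ℝ B := hB.differentiable (by simp)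
  obtain ⟨gA, hgA⟩ := exists_zonalForm_of_inner_cross_gradient_eq_zero (l := l) hn hdA (fun c y _ => hhomA c y) hnA
  obtain ⟨gB, hgB⟩ := exists_zonalForm_of_inner_cross_gradient_eq_zero (l := m) hn hdB (fun c y _ => hhomB c y) hnB
  exact ⟨n, gA, gB, hn, hgA, hgB⟩

end Summit.NavierStokesRegularity.NavierStokesRegularity.Theorems.PoloidalLiouville.HorizonTower

end
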